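import Literature.AlgebraicGeometry.Resolution.PowerSeriesRegularLocal
import Literature.AlgebraicGeometry.Resolution.AlterationsNodeLocalStructure
import Literature.NumberTheory.GaloisRepresentations.NearlyOrdinaryPresentationProofs
import Mathlib.RingTheory.MvPowerSeries.NoZeroDivisors
import HarnessLib

/-!
# `WildQuotients.SummitReduction` (stmt-ResolutionOfSingularities-16324), line `FramePerfect`, stub S
# (`stub_pair_orbitNormalFormBlowup`): the coefficient-free model ring `A⟦u, v⟧/(uv - h)` is
# singular along `u = v = x = y = 0` whenever `x y ∣ h`

Route `ResolutionOfSingularities/WildQuotients`, crux `SummitReduction`; helper file of the line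
skeleton (v8), stub S = the orbit version of de Jong 1996, Claim 4.27 for
`DeJong1997.QuasiSplitNormalFormPair`, whose formal models are the COEFFICIENT-FREE rings
`DeJong1996.NodeDeformationRing A (t₁ ⋯ t_s) = A⟦u, v⟧/(uv - t₁ ⋯ t_s)` over an abstract regular
local ring `A` (de Jong 1997, p. 619: "The types of complete local rings that we have now are
`A⟦u, v⟧/(uv - t₁ ⋯ t_s)`, where `A` is a regular complete local ring with a regular system of
parameters `t₁, …, t_{d-1}`"). The chart computation of 4.27 over the centre starts from the
singular locus of this model ("Since `E` is smooth, its ideal in the rings of (ii) is given by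
`(u, v, t₁, t₂)` after renumbering", de Jong 1996, p. 75); the tree has it only over a field
(`NodalFamilyRingSingularLocus.lean`, by the Jacobian criterion). This file proves the half
`V(u, v, x, y) ⊆ Sing` coefficient-free:

* `isRegularLocalRing_mvPowerSeries_of_isRegularLocalRing` — `A⟦X₁, …, X_n⟧` is a regular local
  ring for `A` regular local (its maximal ideal `𝔪_A + (X)` needs `dim A + n ≤ dim A⟦X⟧`
  generators), hence a regular ring (Serre, tree `isRegularRing_of_isRegularLocalRing`);
* `nodeDeformationRelation_ne_zero`, `nodeDeformationRelation_mem_sq` — `F = uv - xyh'` is a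
  non-zero element of `Q²` for every ideal `Q ∋ u, v, x, y` of `A⟦u, v⟧`;
* `not_isRegularLocalRing_localization_nodeDeformationRing` — **for every prime `𝔮` of
  `A⟦u, v⟧/(uv - xyh')` containing `u, v, x, y`, the local ring at `𝔮` is not regular** (a
  hypersurface `F = 0` in the regular domain `A⟦u, v⟧` is singular along `F ∈ 𝔮²`, tree
  `not_isRegularLocalRing_localization_quotient_of_mem_sq`).

## Sources

* A. J. de Jong, *Smoothness, semi-stability and alterations*, Publ. Math. IHÉS 83 (1996), 3.5
  (p. 64), 4.27 (pp. 75–76). [DeJong1996]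
* A. J. de Jong, *Families of curves and alterations*, Ann. Inst. Fourier 47 (1997), proof of
  Prop. 5.11, p. 619. [DeJong1997]
* H. Matsumura, *Commutative Ring Theory* (1986), Thm. 14.2, Thm. 15.4, Thm. 19.3. [Matsumura1987]
-/

set_option linter.dupNamespace false -- the tree's summit namespace repeats `ResolutionOfSingularities`

noncomputable section

open IsLocalRing
open Literature.AlgebraicGeometry.Resolution
open Literature.NumberTheory.GaloisRepresentations.NearlyOrdinaryPresentationCA

namespace Summit.ResolutionOfSingularities.ResolutionOfSingularities.Theorems

/-! ## Power series over a regular local ring -/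

/-- **`A⟦X₁, …, X_n⟧` is a regular local ring for a regular local ring `A`**: its maximal ideal
`𝔪_A A⟦X⟧ + (X₁, …, X_n)` is generated by `dim A + n` elements while `dim A⟦X⟧ ≥ dim A + n`.
[cite: Matsumura1987, Thm. 15.4 and Thm. 19.5] -/
theorem isRegularLocalRing_mvPowerSeries_of_isRegularLocalRing (A : Type) [CommRing A]
    [IsRegularLocalRing A] (n : ℕ) : IsRegularLocalRing (MvPowerSeries (Fin n) A) := by
  classical
  haveI : IsNoetherianRing (MvPowerSeries (Fin n) A) := isNoetherianRing_mvPowerSeries A (Fin n)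
  refine IsRegularLocalRing.of_spanFinrank_maximalIdeal_le _ ?_
  have fg' := (maximalIdeal A).fg_of_isNoetherianRing
  have fg := Submodule.FG.finite_generators fg'
  -- the maximal ideal is spanned by the images of generators of `𝔪_A` and the variables
  have hspan : maximalIdeal (MvPowerSeries (Fin n) A) =
      Ideal.span ((MvPowerSeries.C (σ := Fin n) (R := A)) '' (maximalIdeal A).generators ∪
        Set.range (MvPowerSeries.X : Fin n → MvPowerSeries (Fin n) A)) := by
    rw [maximalIdeal_mvPowerSeries_eq A n, Ideal.span_union, ← Ideal.map_span]
    congr 2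
    exact ((maximalIdeal A).span_generators).symm
  have hfin : ((MvPowerSeries.C (σ := Fin n) (R := A)) '' (maximalIdeal A).generators ∪
      Set.range (MvPowerSeries.X : Fin n → MvPowerSeries (Fin n) A)).Finite :=
    (fg.image _).union (Set.finite_range _)
  have h1 : ((maximalIdeal (MvPowerSeries (Fin n) A)).spanFinrank : WithBot ℕ∞) ≤
      ((maximalIdeal A).spanFinrank + n : ℕ) := by
    rw [hspan]
    have := Submodule.spanFinrank_span_le_ncard_of_finite (R := MvPowerSeries (Fin n) A)
      (M := MvPowerSeries (Fin n) A) hfin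
    refine (Nat.cast_le.mpr (this.trans ?_))
    refine (Set.ncard_union_le _ _).trans (add_le_add ?_ ?_)
    · rw [← Submodule.FG.generators_ncard fg']
      exact Set.ncard_image_le fg
    · rw [← Set.image_univ]
      refine (Set.ncard_image_le Set.finite_univ).trans ?_
      rw [Set.ncard_univ, Nat.card_eq_fintype_card, Fintype.card_fin]
  refine h1.trans ?_
  have h2 := ringKrullDim_add_le_ringKrullDim_mvPowerSeries A n
  have h3 : ((maximalIdeal A).spanFinrank : WithBot ℕ∞) = ringKrullDim A :=
    IsRegularLocalRing.spanFinrank_maximalIdeal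
  calc (((maximalIdeal A).spanFinrank + n : ℕ) : WithBot ℕ∞)
      = ((maximalIdeal A).spanFinrank : WithBot ℕ∞) + n := by push_cast; rfl
    _ = ringKrullDim A + n := by rw [h3]
    _ ≤ ringKrullDim (MvPowerSeries (Fin n) A) := h2

/-- `A⟦X₁, …, X_n⟧` over a regular local ring is a regular ring (Serre).
[cite: Matsumura1987, Thm. 19.3] -/
theorem isRegularRing_mvPowerSeries_of_isRegularLocalRing (A : Type) [CommRing A]
    [IsRegularLocalRing A] (n : ℕ) : IsRegularRing (MvPowerSeries (Fin n) A) :=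
  haveI := isRegularLocalRing_mvPowerSeries_of_isRegularLocalRing A n
  isRegularRing_of_isRegularLocalRing _

/-! ## The relation `uv - h` -/

/-- The relation `uv - h` of the model ring is non-zero: its `uv`-coefficient is `1`.
[cite: DeJong1996, 2.23, p. 62] -/
theorem nodeDeformationRelation_ne_zero {A : Type} [CommRing A] [Nontrivial A] (h : A) :
    DeJong1996.nodeDeformationRelation A h ≠ 0 := by
  classical
  intro h0
  have := congrArg (MvPowerSeries.coeff (Finsupp.single (0 : Fin 2) 1 + Finsupp.single 1 1)) h0
  rw [DeJong1996.nodeDeformationRelation, map_sub, map_zero, MvPowerSeries.X, MvPowerSeries.X,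
    MvPowerSeries.monomial_mul_monomial, MvPowerSeries.coeff_monomial_same, mul_one,
    MvPowerSeries.coeff_C, if_neg] at this
  · exact one_ne_zero (sub_zero (1 : A) ▸ this)
  · intro heq
    have := DFunLike.congr_fun heq 0
    simp at this

/-- **`uv - xyh' ∈ Q²`** for every ideal `Q` of `A⟦u, v⟧` containing `u, v, x, y`.
[cite: DeJong1996, 4.27, p. 75] -/
theorem nodeDeformationRelation_mem_sq {A : Type} [CommRing A] (x y h' : A)
    (Q : Ideal (MvPowerSeries (Fin 2) A)) (hu : MvPowerSeries.X 0 ∈ Q) (hv : MvPowerSeries.X 1 ∈ Q)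
    (hx : MvPowerSeries.C x ∈ Q) (hy : MvPowerSeries.C y ∈ Q) :
    DeJong1996.nodeDeformationRelation A (x * y * h') ∈ Q ^ 2 := by
  rw [DeJong1996.nodeDeformationRelation, map_mul, map_mul]
  refine Ideal.sub_mem _ ?_ (Ideal.mul_mem_right _ _ ?_)
  · rw [pow_two]
    exact Ideal.mul_mem_mul hu hv
  · rw [pow_two]
    exact Ideal.mul_mem_mul hx hy

/-! ## `V(u, v, x, y) ⊆ Sing` -/

/-- **The model ring `A⟦u, v⟧/(uv - xyh')` is singular at every prime containing `u, v, x, y`**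
(de Jong 1996, 3.5/4.27: the components `u = v = t_a = t_b = 0` of the singular locus of
`A⟦u, v⟧/(uv - t₁ ⋯ t_s)`), coefficient-free: `A` any regular local ring. The hypersurface
`F = uv - xyh'` of the regular domain `A⟦u, v⟧` has `0 ≠ F ∈ Q²` for the prime `Q` of `A⟦u, v⟧`
under `𝔮`, so `(A⟦u, v⟧/(F))_𝔮 = A⟦u, v⟧_Q/(F)` is not regular.
[cite: DeJong1996, 4.27, p. 75] [cite: DeJong1997, proof of Prop. 5.11, p. 619] -/
theorem not_isRegularLocalRing_localization_nodeDeformationRing {A : Type} [CommRing A]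
    [IsRegularLocalRing A] (x y h' : A)
    (𝔮 : Ideal (DeJong1996.NodeDeformationRing A (x * y * h'))) [𝔮.IsPrime]
    (hu : Ideal.Quotient.mk _ (MvPowerSeries.X 0) ∈ 𝔮)
    (hv : Ideal.Quotient.mk _ (MvPowerSeries.X 1) ∈ 𝔮)
    (hx : DeJong1996.NodeDeformationRing.ofBase A _ x ∈ 𝔮)
    (hy : DeJong1996.NodeDeformationRing.ofBase A _ y ∈ 𝔮) :
    ¬ IsRegularLocalRing (Localization.AtPrime 𝔮) := by
  haveI := isRegularRing_mvPowerSeries_of_isRegularLocalRing A 2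
  haveI : IsDomain A := isDomain_of_isRegularLocalRing A
  haveI : IsDomain (MvPowerSeries (Fin 2) A) := NoZeroDivisors.to_isDomain _
  refine not_isRegularLocalRing_localization_quotient_of_mem_sq
    (nodeDeformationRelation_ne_zero (x * y * h')) 𝔮 ?_
  exact nodeDeformationRelation_mem_sq x y h' _ hu hv hx hy

end Summit.ResolutionOfSingularities.ResolutionOfSingularities.Theorems

end
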